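import Literature.MathematicalPhysics.QuantumFieldTheory.Balaban1983to89.B1Eq323ConnectedGraphBound
import Literature.MathematicalPhysics.QuantumFieldTheory.Balaban1983to89.B1Eq357FluctuationPolynomial
import Literature.MathematicalPhysics.QuantumFieldTheory.Balaban1983to89.HiggsFluctMeasureWick
import Literature.MathematicalPhysics.QuantumFieldTheory.Balaban1983to89.B10Eq24Cumulant
import Literature.MathematicalPhysics.QuantumFieldTheory.Balaban1983to89.HiggsCondGaussMoments

/-!
# `Balaban1983to89.B1Eq323DisplayedCumulantBound` — T. Bałaban, *(Higgs)₂,₃ quantum fields in a finite volume. I. A lower bound*,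
Commun. Math. Phys. **85** (1982) 603–626 [Balaban1982Higgs1], p. 616 [PDF 14], the sentence after (3.23):
**«⟨Vⁿ⟩^T is the expression corresponding to the sum of connected graphs with exponentially decaying propagators. Hence
⟨Vⁿ⟩^T = O(ε^κ)|T₁| with κ > d for n sufficiently large, e.g. n > 6»** — FOR THE DISPLAYED `V^{(k)}` OF (3.57) ON THE LAW OF (3.56):
the Gaussian law `dμ_{C^{(k)}}(A′)dμ_{C^{(k)}(B^{(k+1)})}(φ′)` (the typer's `law356 = fluctMeasure ⊗ condGauss`) presented as p13's normalized
centred Gaussian `gexp A 0` of an explicit BLOCK-DIAGONAL PRECISION MATRIX, the unit-lattice legs of (1.22)/(3.57) as linear functionals of the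
coordinates, hence `⟨(V^{(k)})ⁿ⟩^T` = p33's Ursell function of `n` copies of `V^{(k)}`, and — by r14's connected-graph volume bound
`B1Eq323ConnectedGraphBound.abs_ursellOf_jmoment_le` — **`|⟨(V^{(k)})ⁿ⟩^T| ≦ connConst·A₀ⁿ·|T^{(k)}|`** under (3.58) and exponentially
decaying propagators, the latter REDUCED (§6) to Prop. 2.3 (2.34) for the two covariances `C^{(k)}` (2.30) and `C^{(k)}(B^{(k+1)})` (2.32)
(theorems + definitions with bodies; no `Prop` fact)

statement-level skeleton of published theorems with citation tags; proofs where landed; nothing here is a claim about the Yang–Mills mass gap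

PDF held: `paper:balaban1982-cmp85-higgs23-i` (journal page = PDF page + 602); p. 616 [PDF 14] read on the OCR text
`~/.lit/texts/paper-balaban1982-cmp85-higgs23-i/p0014.txt` and the ×2 render
`run/shared/lean/pub/pub-balaban/b2b-balaban-ref1/pages/1982-cmp85-higgs23-I/1982-cmp85-higgs23-I-p014-x2.png`; p. 617 [PDF 15]
(independence of the fluctuation fields), p. 622 [PDF 20] ((3.56)–(3.58)).

CITATION HEADER (lean-in-tree rule).  Cell `lit-balaban` (HOME `run/shared/lean/pub/lit-balaban/`), reader/typer seat **r14** (B1 fold owner),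
gen 26, free-target protocol G.5-34 (d) (TAKING HOME/STATUS.md 2026-08-25T08:01Z, ADDENDUM 08:17Z, successor member announced there), ZERO head
weight: an OPTIONAL LOCATED MEMBER of the rows **B1.Eq3.23** / **B1.Eq3.24** (owner r12, `HOME/lit-balaban-r12/ROWS-B1-part2.md`) and
**B1.Eq3.59** (owner r14, `HOME/lit-balaban-r14/ROWS-B1.md`; class D, head unchanged), the successor member named in the HONEST SCOPE (i) of
r14's `B1Eq323ConnectedGraphBound` (the transport of the law of (3.56) to p13's `gexp`).  USED BY NAME, nothing re-declared: the typer's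
`B1Eq357FluctuationPolynomial.{Crd, law356, law356_eq, isProbabilityMeasure_law356, rv357, rv357_eq_sum_prod, Idx, coefOf, slots, legRV,
legRV_of_lt, legVal_inl, legVal_inr}` ((3.56)/(3.57) on the product carrier, the slot normal form), `HiggsFluctMeasureWick.exists_precMatrix`
(the precision matrix of `dμ_{C^{(j)}}`), `HiggsFluctMeasure.{fluctMeasure_eq, gaussWeight, gaussWeight_eq, gaussNorm, measurable_gaussWeight,
gaussWeight_nonneg}`, `HiggsFluctMeasurePos.{siteInner_precOp_pos, eq_zero_of_toSite_eq_zero, gaussNorm_pos}`,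
`HiggsFluctMeasureCov.siteInner_precOp_comm`, `HiggsCondGauss228.{condGauss_eq, inSet, formMat, fieldOfCrd, blkIn_formMat_posDef,
siteInner_fieldOfCrd}` (the conditioned scalar Gaussian IS p15's `gaussProb (blkIn (inSet N Λ) formMat)`), p15's `B2Eq228Conditioning.{In, resIn,
blkIn, weight, source, gaussProb, gaussNorm_pos, measurable_gaussWeight_real, gaussWeight_pos}` and `B13GaugeDevices.{gaussWeight, gaussNorm}`,
r14's `B1Eq324SmallFieldLeaf.{siteDelta, siteInner_siteDelta}` and `B1Eq221Coordinates.fieldCoord`, p14's `B1Prop32InteractionBound.{Leg, legVal,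
card_leg}` and `B1Ineq358TreeDecaySum.diam`, p13's `BIJ88TruncationConnected306.gexp`, p33's `B3GaussianPerturbationGraphs.{jmoment, clusterVar,
legProd, source_zero}`, p36's `B10Eq24Cumulant.nmoment`, `Literature.Probability.LatticeModels.{ursellOf, cumulantOf}` (the cumulant
`cumulantOf (nmoment V μ) n` is the quantity of the B1.Eq3.59 chain, the typer's `B1Eq324DisplayedInteractionLeaf`), r14's
`B1Eq323ConnectedGraphBound.{cdeg, connConst, abs_ursellOf_jmoment_le}`, and for §6 the covariance identities of record
`HiggsFluctMeasureCov.{integral_siteInner_fluctMeasure, integral_siteInner_mul_siteInner_fluctMeasure}` (`dμ_{C^{(k)}}` is centred with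
covariance `HiggsFluctMeasure.fluctCov` = `C^{(k)}` of (2.30)), `HiggsCondGaussMoments.{integral_siteInner_condGauss,
integral_siteInner_mul_siteInner_condGauss}` (`dμ_{C^{(k)}_Λ(Ω,B)}` is centred with covariance `HiggsCondCov232.condCov232` (2.32)), r14's
`B1Eq324SmallFieldLeaf.{bondDelta, siteInner_bondDelta}`; Mathlib's `MeasurableEquiv.sumPiEquivProdPi`, `volume_measurePreserving_sumPiEquivProdPi`,
`prod_withDensity`, `integral_prod_mul`, `Matrix.fromBlocks`.

THE PRINT.  P. 616 (verbatim from the OCR, checked on the render): *"… where ⟨·⟩ denotes the expectation value with respect to the measure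
dμ_{C^{(0)}}(A′)dμ_{C^{(0)}(B^{(1)})}(φ′), V = V^{(0)} and ⟨Vⁿ⟩^T denotes the truncated expectation of a product of n polynomials V … The
coefficients of the polynomial V are proportional to some positive powers of ε. The smallest such power is ε^{1/2} and ⟨Vⁿ⟩^T is the expression
corresponding to the sum of connected graphs with exponentially decaying propagators. Hence ⟨Vⁿ⟩^T = O(ε^κ)|T₁| with κ > d for n sufficiently
large, e.g. n > 6."*  P. 617: *"The fields A′^{(j)} defining the components of (3.33) are independent Gaussian random variables with the
covariances C^{(j),L^jε}"* (and, next sentence, independent of the field `A`).  P. 622, Prop. 3.2: (3.56) the integral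
`∫dμ_{C^{(k)}}(A′)∫dμ_{C^{(k)}(B^{(k+1)})}(φ′) χ χ exp V^{(k)}`, (3.57) the polynomial `V^{(k)} = Σ_q Σ_z Σ_κ v^{(k)}(q;z;κ)·Π legs` in the
unit-lattice components `(L^kε)^{(d−2)/2}φ′_j(x)`, `(L^kε)^{(d−2)/2}A′_μ(y)` of (1.22), (3.58) `|v^{(k)}(…)| ≦ O(1)(L^kε)^{κ₀}exp(−δ₀d(x₁,…,y_m))`.

THE MATHEMATICS MADE A THEOREM HERE.  §1 The Gaussian `dμ_{C^{(k)}}(A′) = Z₁⁻¹e^{−½⟨A′,(C^{(k)})⁻¹A′⟩}dA′` on the bonds has the precision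
MATRIX `precMat` (the typer's `exists_precMatrix`, chosen once), symmetric (`siteInner_precOp_comm`) and positive definite (`m², a > 0`, `L > 1`,
`k ≤ K`; `siteInner_precOp_pos`), and its weight is p15's `weight precMat`.  §2 On the coordinate index set `S356 = PBond ⊕ In(inSet N T^{(k)})`
the BLOCK-DIAGONAL matrix `blockPrec = fromBlocks precMat 0 0 (blkIn formMat)` has the quadratic form `= ⟨A′,precMat A′⟩ + ⟨x, A_Λ x⟩` at
`(A′, x) = Ψ φ` (`Ψ` = Mathlib's `sumPiEquivProdPi`), so its weight FACTORIZES into the two Gaussian weights and it is positive definite.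
§3 **`∫ G d(law356) = gexp blockPrec 0 (G ∘ Ψ)`** for every `G` (`integral_law356_eq_gexp`): both factors of `law356` are `Z⁻¹·(Lebesgue with
density)` (`fluctMeasure_eq`, `condGauss_eq`), the product density is the product (`prod_withDensity`), `Ψ` preserves Lebesgue measure, and the
normalisations are `∫ weight = Z₁Z₂` (`integral_weight_blockPrec`) — the print's expectation `⟨·⟩` IS p13's normalized Gaussian expectation.
§4 Every unit-lattice leg is a linear functional of the coordinates: `legVal k A′ φ′ l y = φ·legVecS k l y` at `(A′,x) = Ψφ`, `φ′ = fieldOfCrd x`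
(`dotProduct_legVecS`; the scalar leg through `siteInner_siteDelta`/`siteInner_fieldOfCrd`), so with the leg vectors `lvOf c i` of a monomial
index `c = (q,z,κ)` p33's cluster variable with all indices allowed, coefficients `coefOf` and degrees `q` IS `V^{(k)} ∘ Ψ` (`clusterVar_eq_rv357`,
the typer's slot normal form).  §5 Hence p33's subset moments `⟨Π_{j∈Q}X_j⟩` are the moments `⟨(V^{(k)})^{|Q|}⟩` of (3.23) on `law356`
(`jmoment_blockPrec_eq_nmoment`), the cumulant `⟨(V^{(k)})ⁿ⟩^T = cumulantOf (nmoment rv357 law356) n` IS p33's Ursell function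
(`cumulantOf_rv357_eq_ursellOf`, definitional on the `LatticeModels` side), and r14's `abs_ursellOf_jmoment_le` gives the bound
**`abs_cumulantOf_rv357_le`**: for `n ≧ 1`, under (3.58) in the diameter currency `|v^{(k)}(q;z;κ)| ≦ A₀e^{−δ₀·diam z}` (the typer's `h358` shape,
`q ≤ qmax`) and *"exponentially decaying propagators"* `|⟨X_l(y)X_{l′}(y′)⟩_{law356}| ≦ c₀e^{−δ₁|y−y′|}` for the unit-lattice legs,
  `|⟨(V^{(k)})ⁿ⟩^T| ≦ connConst(d, N+d, n, qmax, c₀, δ₀, δ₁) · A₀ⁿ · |T^{(k)}|`,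
and with `A₀ = C_v(L^kε)^{κ₀}` ((3.58) as printed) `≦ connConst·C_vⁿ·(L^kε)^{κ₀n}·|T^{(k)}|` (`abs_cumulantOf_rv357_le_scale`) — the print's
*"O(ε^κ)|T₁| with κ > d for n sufficiently large"* (`κ = nκ₀`; at `k = 0`, `L^kε = ε`).  §6 THE PROPAGATORS: the second moments of the
legs under `law356` ARE `(L^kε)^{d−2}×` the covariance kernels in the pairing (1.5) — vector–vector `⟨δ_b, C^{(k)}δ_{b′}⟩` ((2.30), the typer's
`integral_siteInner_mul_siteInner_fluctMeasure`), scalar–scalar `⟨δ_{y,j}, C^{(k)}(B^{(k+1)})δ_{y′,j′}⟩` ((2.32) at `Λ = T^{(k)}`,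
`integral_siteInner_mul_siteInner_condGauss`), mixed `0` (independence p. 617, both factors centred; `integral_prod_mul`) —
`integral_legVal_mul_legVal` with the kernel `propKer`; hence Prop. 2.3 (2.34) for the two covariances in the level currency of the tree,
`|⟨δ_b, C^{(k)}δ_{b′}⟩| ≦ c_A(L^kε)^{−(d−2)}e^{−δ₁|b−b′|}`, `|⟨δ_{y,j}, C^{(k)}(B^{(k+1)})δ_{y′,j′}⟩| ≦ c_φ(L^kε)^{−(d−2)}e^{−δ₁|y−y′|}`, gives the propagator
hypothesis with the SCALE-FREE `c₀ = max(c_A,c_φ)` (the leg normalisation `(L^kε)^{(d−2)/2}` of (1.22) cancels the level factor;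
`abs_integral_legVal_mul_legVal_le`) and **`abs_cumulantOf_rv357_le_of_ineq234`**
(+ `_scale`): `|⟨(V^{(k)})ⁿ⟩^T| ≦ connConst·A₀ⁿ·|T^{(k)}|` (`≦ connConst·C_vⁿ·(L^kε)^{κ₀n}·|T^{(k)}|`) from (3.58) and (2.34) alone, every constant
independent of `k`, `ε` and the volume.

HONEST SCOPE.  (i) Prop. 2.3 (2.34) enters as two kernel HYPOTHESES (`h234A` for `C^{(k)}` of (2.30), `h234φ` for `C^{(k)}(B^{(k+1)})` of (2.32)),
in the (1.5)-pairing currency of the tree; the block's typed instances of (2.34) (row B1.Prop2.3: `B1Ineq234Concrete`, `B1Ineq234LevelZero`,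
`B1Ineq234ZeroFieldRegionUniform`, `B1Ineq234BackgroundTorus`, … — specific backgrounds/regions, their own currencies) are NOT composed here.
(ii) (3.58) is taken in the diameter currency (weaker than the printed Steiner length `d(…) ≧ diam`, as in p14's
`B1Prop32InteractionBound`).  (iii) The constant is r14's crude `connConst` (print: "O(1)"); no optimisation of `κ` ("e.g. n > 6" is the print's
arithmetic `nκ₀ > d` with `κ₀ ≧ 1/2`, not asserted here).  (iv) No claim about the χ-weighted cumulants / the remainder of (3.24)/(3.59) (the lemma
of Benfatto et al. [2] p. 152, NOT HELD, `HOME/MISSING-SOURCES.md`); rows B1.Eq3.24 / B1.Eq3.59 keep their heads.  (v) Zero `sorry`, no new `Prop`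
fact; axioms standard.
-/

noncomputable section

open Finset Matrix MeasureTheory
open scoped BigOperators ENNReal

namespace Literature.MathematicalPhysics.QuantumFieldTheory.Balaban1983to89.B1Eq323DisplayedCumulantBound

open HiggsLattice (ChargeData siteInner)
open B3MultiscaleFields (toSite)
open HiggsFluctMeasure (fluctMeasure precOp)
open HiggsCondGauss228 (condGauss fieldOfCrd inSet formMat)
open B2Eq228Conditioning (In blkIn weight source gaussProb)
open Literature.MathematicalPhysics.QuantumFieldTheory.BalabanImbrieJaffe1984to88.BIJ88TruncationConnected306 (gexp)
open B1Eq357FluctuationPolynomial (Crd law356 rv357 Idx coefOf slots legRV)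

/-! ## §1 The precision matrix of `dμ_{C^{(j),L^jη}}(A′)` as a symmetric positive definite matrix -/

section PrecMat

variable {P : HiggsLattice.Params}

/-- `(C^{(j)})^{−1}` as a matrix on the bonds (the typer's `HiggsFluctMeasureWick.exists_precMatrix`, chosen).
[cite: Balaban1982Higgs1, (2.30) p.611] -/
def precMat (P : HiggsLattice.Params) (msq a : ℝ) (j : ℕ) : Matrix (HiggsLattice.PBond P j) (HiggsLattice.PBond P j) ℝ :=
  Classical.choose (HiggsFluctMeasureWick.exists_precMatrix (P := P) msq a j)

/-- `A·(Q u) = ⟨A, (C^{(j)})^{−1}u⟩`. [cite: Balaban1982Higgs1, (2.30) p.611] -/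
theorem dotProduct_precMat_mulVec (msq a : ℝ) (j : ℕ) (A u : HiggsLattice.VecField P j) :
    A ⬝ᵥ precMat P msq a j *ᵥ u = siteInner (toSite A) (precOp P msq a j (toSite u)) :=
  Classical.choose_spec (HiggsFluctMeasureWick.exists_precMatrix (P := P) msq a j) A u

open Classical in
/-- The entries of the precision matrix. [cite: Balaban1982Higgs1, (2.30) p.611] -/
theorem precMat_apply (msq a : ℝ) (j : ℕ) (i i' : HiggsLattice.PBond P j) :
    precMat P msq a j i i' = siteInner (toSite (Pi.single i 1 : HiggsLattice.VecField P j)) (precOp P msq a j (toSite (Pi.single i' 1))) := by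
  classical
  rw [← dotProduct_precMat_mulVec, single_dotProduct, one_mul, Matrix.mulVec, dotProduct_single, mul_one]

/-- The precision matrix is symmetric ((C^{(j)})^{−1} is self-adjoint for (1.5), `HiggsFluctMeasureCov.siteInner_precOp_comm`).
[cite: Balaban1982Higgs1, (2.30) p.611] -/
theorem precMat_isHermitian (msq a : ℝ) (j : ℕ) : (precMat P msq a j).IsHermitian := by
  classical
  refine Matrix.IsHermitian.ext fun i i' => ?_
  rw [star_trivial, precMat_apply, precMat_apply, HiggsFluctMeasureCov.siteInner_precOp_comm]

/-- The precision matrix is positive definite (m² > 0, a > 0, L > 1, j ≤ K; `HiggsFluctMeasurePos.siteInner_precOp_pos`).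
[cite: Balaban1982Higgs1, (2.30) p.611] -/
theorem precMat_posDef {msq a : ℝ} (hmsq : 0 < msq) (ha : 0 < a) (hL : 1 < (P.L : ℝ)) {j : ℕ} (hj : j ≤ P.K) :
    (precMat P msq a j).PosDef := by
  classical
  refine Matrix.PosDef.of_dotProduct_mulVec_pos (precMat_isHermitian msq a j) fun x hx => ?_
  rw [star_trivial, dotProduct_precMat_mulVec]
  exact HiggsFluctMeasurePos.siteInner_precOp_pos hmsq ha hL hj fun h => hx (HiggsFluctMeasurePos.eq_zero_of_toSite_eq_zero h)

/-- The Gaussian weight of `dμ_{C^{(j)}}` is p13's `weight` of the precision matrix. [cite: Balaban1982Higgs1, (3.35) p.618] -/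
theorem gaussWeight_eq_weight (msq a : ℝ) (j : ℕ) (A : HiggsLattice.VecField P j) :
    HiggsFluctMeasure.gaussWeight P msq a j A = weight (precMat P msq a j) A := by
  rw [HiggsFluctMeasure.gaussWeight_eq, weight, dotProduct_precMat_mulVec]

end PrecMat

/-! ## §2 The law of (3.56) in p13's presentation: index set, block-diagonal precision, the coordinate map -/

section Law

variable {P : HiggsLattice.Params} {N : ℕ}
  (C : ChargeData N) (Ω : Finset (HiggsLattice.Site P 0)) (B : HiggsLattice.VecField P 0) (μ0sq msq a : ℝ) (k : ℕ)

/-- The coordinate index set of the product space of (3.56): the bonds of `T^{(k)}` (the `A′`-coordinates) and the scalar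
coordinates `In (inSet N T^{(k)})` (the `φ′`-coordinates of the typer's `Crd`). [cite: Balaban1982Higgs1, (3.56) p.622] -/
abbrev S356 (P : HiggsLattice.Params) (N k : ℕ) : Type :=
  HiggsLattice.PBond P k ⊕ In (inSet (P := P) N (Finset.univ : Finset (HiggsLattice.Site P k)))

/-- THE BLOCK-DIAGONAL PRECISION MATRIX of the product Gaussian `dμ_{C^{(k)}}(A′)dμ_{C^{(k)}(B^{(k+1)})}(φ′)`: `(C^{(k)})^{−1}` on the
bonds (`precMat`), the typer's `A_Λ = blkIn (inSet N T^{(k)}) formMat` on the scalar coordinates, no cross terms (independence, p. 617).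
[cite: Balaban1982Higgs1, (3.56) p.622] -/
def blockPrec : Matrix (S356 P N k) (S356 P N k) ℝ :=
  Matrix.fromBlocks (precMat P μ0sq a k) 0 0 (blkIn (inSet N (Finset.univ : Finset (HiggsLattice.Site P k))) (formMat C Ω B msq a k))

/-- The coordinate map `φ ↦ (A′, x)`: `A′_b = φ(inl b)`, `x_s = φ(inr s)` (Mathlib's `Equiv.sumPiEquivProdPi`).
[cite: Balaban1982Higgs1, (3.56) p.622] -/
def Ψ (φ : S356 P N k → ℝ) : HiggsLattice.VecField P k × Crd P N k :=
  (fun b => φ (Sum.inl b), fun s => φ (Sum.inr s))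

/-- `Ψ` is the measurable equivalence `sumPiEquivProdPi`. [cite: Balaban1982Higgs1, (3.56) p.622] -/
theorem sumPiEquivProdPi_apply (φ : S356 P N k → ℝ) :
    MeasurableEquiv.sumPiEquivProdPi (fun _ : S356 P N k => ℝ) φ = Ψ k φ := rfl

/-- The quadratic form of the block-diagonal precision splits. [cite: Balaban1982Higgs1, (3.56) p.622] -/
theorem dotProduct_blockPrec_mulVec (φ : S356 P N k → ℝ) :
    φ ⬝ᵥ blockPrec C Ω B μ0sq msq a k *ᵥ φ
      = (Ψ k φ).1 ⬝ᵥ precMat P μ0sq a k *ᵥ (Ψ k φ).1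
        + (Ψ k φ).2 ⬝ᵥ blkIn (inSet N (Finset.univ : Finset (HiggsLattice.Site P k))) (formMat C Ω B msq a k) *ᵥ (Ψ k φ).2 := by
  have hφ : φ = Sum.elim (fun b => φ (Sum.inl b)) (fun s => φ (Sum.inr s)) := by
    ext (b | s) <;> rfl
  conv_lhs => rw [hφ]
  rw [blockPrec, Matrix.fromBlocks_mulVec, Sum.elim_comp_inl, Sum.elim_comp_inr, Matrix.zero_mulVec, Matrix.zero_mulVec, add_zero,
    zero_add, sumElim_dotProduct_sumElim]
  rfl

/-- **The Gaussian weight of the block precision factorizes** into the weights of `dμ_{C^{(k)}}(A′)` and `dμ_{C^{(k)}(B^{(k+1)})}(φ′)`.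
[cite: Balaban1982Higgs1, (3.56) p.622] -/
theorem weight_blockPrec (φ : S356 P N k → ℝ) :
    weight (blockPrec C Ω B μ0sq msq a k) φ
      = HiggsFluctMeasure.gaussWeight P μ0sq a k (Ψ k φ).1
        * B13GaugeDevices.gaussWeight (blkIn (inSet N (Finset.univ : Finset (HiggsLattice.Site P k))) (formMat C Ω B msq a k)) (Ψ k φ).2 := by
  rw [weight, dotProduct_blockPrec_mulVec, gaussWeight_eq_weight, weight, B13GaugeDevices.gaussWeight, ← Real.exp_add]
  congr 1
  ring

/-- The block precision is positive definite (both blocks are: `precMat_posDef`, the typer's `blkIn_formMat_posDef`).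
[cite: Balaban1982Higgs1, (3.56) p.622] -/
theorem blockPrec_posDef {μ0sq msq a : ℝ} (hμ : 0 < μ0sq) (hmsq : 0 < msq) (ha : 0 < a) (hL : 1 < (P.L : ℝ)) {k : ℕ} (hk : k ≤ P.K) :
    (blockPrec C Ω B μ0sq msq a k).PosDef := by
  classical
  have h1 := precMat_posDef (P := P) hμ ha hL hk
  have h2 := HiggsCondGauss228.blkIn_formMat_posDef C Ω B hmsq ha hL hk (Finset.univ : Finset (HiggsLattice.Site P k))
  refine Matrix.PosDef.of_dotProduct_mulVec_pos ?_ fun x hx => ?_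
  · unfold blockPrec
    exact Matrix.IsHermitian.fromBlocks h1.isHermitian (by simp) h2.isHermitian
  · rw [star_trivial, dotProduct_blockPrec_mulVec]
    have hq1 : 0 ≤ (Ψ k x).1 ⬝ᵥ precMat P μ0sq a k *ᵥ (Ψ k x).1 := by
      have := h1.posSemidef.dotProduct_mulVec_nonneg (Ψ k x).1
      rwa [star_trivial] at this
    have hq2 : 0 ≤ (Ψ k x).2 ⬝ᵥ blkIn (inSet N (Finset.univ : Finset (HiggsLattice.Site P k))) (formMat C Ω B msq a k) *ᵥ (Ψ k x).2 := by
      have := h2.posSemidef.dotProduct_mulVec_nonneg (Ψ k x).2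
      rwa [star_trivial] at this
    by_cases h1z : (Ψ k x).1 = 0
    · have h2z : (Ψ k x).2 ≠ 0 := by
        intro h2z
        apply hx
        funext i
        rcases i with b | t
        · exact congr_fun h1z b
        · exact congr_fun h2z t
      have := h2.dotProduct_mulVec_pos h2z
      rw [star_trivial] at this
      linarith
    · have := h1.dotProduct_mulVec_pos h1z
      rw [star_trivial] at this
      linarith

end Law

/-! ## §3 Integration against the law of (3.56) is p13's normalized Gaussian expectation `gexp` -/

section Transport

variable {P : HiggsLattice.Params} {N : ℕ}
  (C : ChargeData N) (Ω : Finset (HiggsLattice.Site P 0)) (B : HiggsLattice.VecField P 0)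

/-- The product of the two Gaussian weights, transported to `S356 → ℝ`, integrates to the product of the normalisations.
[cite: Balaban1982Higgs1, (3.56) p.622] -/
theorem integral_weight_blockPrec (μ0sq msq a : ℝ) (k : ℕ) :
    ∫ φ : S356 P N k → ℝ, weight (blockPrec C Ω B μ0sq msq a k) φ
      = HiggsFluctMeasure.gaussNorm P μ0sq a k
        * B13GaugeDevices.gaussNorm (blkIn (inSet N (Finset.univ : Finset (HiggsLattice.Site P k))) (formMat C Ω B msq a k)) := by
  have hΨ : MeasurePreserving (MeasurableEquiv.sumPiEquivProdPi fun _ : S356 P N k => ℝ) volume volume :=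
    volume_measurePreserving_sumPiEquivProdPi _
  simp_rw [weight_blockPrec]
  have h : ∫ φ : S356 P N k → ℝ, HiggsFluctMeasure.gaussWeight P μ0sq a k (Ψ k φ).1
        * B13GaugeDevices.gaussWeight (blkIn (inSet N (Finset.univ : Finset (HiggsLattice.Site P k))) (formMat C Ω B msq a k)) (Ψ k φ).2
      = ∫ z : HiggsLattice.VecField P k × Crd P N k, HiggsFluctMeasure.gaussWeight P μ0sq a k z.1
        * B13GaugeDevices.gaussWeight (blkIn (inSet N (Finset.univ : Finset (HiggsLattice.Site P k))) (formMat C Ω B msq a k)) z.2 :=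
    hΨ.integral_comp (MeasurableEquiv.measurableEmbedding _)
      (fun z : HiggsLattice.VecField P k × Crd P N k => HiggsFluctMeasure.gaussWeight P μ0sq a k z.1
        * B13GaugeDevices.gaussWeight (blkIn (inSet N (Finset.univ : Finset (HiggsLattice.Site P k))) (formMat C Ω B msq a k)) z.2)
  rw [h, Measure.volume_eq_prod, integral_prod_mul]
  rfl

/-- **INTEGRATION AGAINST `dμ_{C^{(k)}}(A′)dμ_{C^{(k)}(B^{(k+1)})}(φ′)` IS p13's `gexp` OF THE BLOCK PRECISION** (coordinates `Ψ`): for every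
function `G` of the two fluctuation fields, `∫ G d(law356) = gexp (blockPrec) 0 (G ∘ Ψ)` (`m², μ₀² > 0`, `a > 0`, `L > 1`, `k ≤ K`; both sides
are the same junk value when `G` is not integrable). [cite: Balaban1982Higgs1, (3.56) p.622] -/
theorem integral_law356_eq_gexp {μ0sq msq a : ℝ} (hμ : 0 < μ0sq) (hmsq : 0 < msq) (ha : 0 < a) (hL : 1 < (P.L : ℝ))
    {k : ℕ} (hk : k ≤ P.K) (G : HiggsLattice.VecField P k × Crd P N k → ℝ) :
    ∫ ω, G ω ∂(law356 C Ω B μ0sq msq a k) = gexp (blockPrec C Ω B μ0sq msq a k) 0 (fun φ => G (Ψ k φ)) := by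
  classical
  set M := blkIn (inSet N (Finset.univ : Finset (HiggsLattice.Site P k))) (formMat C Ω B msq a k) with hM
  set w₁ : HiggsLattice.VecField P k → ℝ := HiggsFluctMeasure.gaussWeight P μ0sq a k with hw₁
  set w₂ : Crd P N k → ℝ := B13GaugeDevices.gaussWeight M with hw₂
  set Z₁ : ℝ := HiggsFluctMeasure.gaussNorm P μ0sq a k with hZ₁
  set Z₂ : ℝ := B13GaugeDevices.gaussNorm M with hZ₂
  have hZ₁pos : 0 < Z₁ := HiggsFluctMeasurePos.gaussNorm_pos hμ ha hL hk
  have hZ₂pos : 0 < Z₂ := B2Eq228Conditioning.gaussNorm_pos (HiggsCondGauss228.blkIn_formMat_posDef C Ω B hmsq ha hL hk _)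
  have hw₁m : Measurable w₁ := HiggsFluctMeasure.measurable_gaussWeight μ0sq a k
  have hw₂m : Measurable w₂ := B2Eq228Conditioning.measurable_gaussWeight_real M
  have hw₁0 : ∀ x, 0 ≤ w₁ x := fun x => HiggsFluctMeasure.gaussWeight_nonneg μ0sq a k x
  have hw₂0 : ∀ x, 0 ≤ w₂ x := fun x => (B2Eq228Conditioning.gaussWeight_pos M x).le
  -- (1) the law of (3.56) as a density with respect to Lebesgue measure on the product
  have hlaw : law356 C Ω B μ0sq msq a k
      = ((ENNReal.ofReal Z₁)⁻¹ * ENNReal.ofReal Z₂⁻¹) •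
          (volume : Measure (HiggsLattice.VecField P k × Crd P N k)).withDensity
            (fun z => ENNReal.ofReal (w₁ z.1) * ENNReal.ofReal (w₂ z.2)) := by
    rw [B1Eq357FluctuationPolynomial.law356_eq, HiggsFluctMeasure.fluctMeasure_eq, HiggsCondGauss228.condGauss_eq, gaussProb,
      Measure.prod_smul_left, Measure.prod_smul_right, smul_smul, prod_withDensity hw₁m.ennreal_ofReal hw₂m.ennreal_ofReal,
      ← Measure.volume_eq_prod]
  -- (2) the integral against the law
  have hF : AEMeasurable (fun z : HiggsLattice.VecField P k × Crd P N k => ENNReal.ofReal (w₁ z.1) * ENNReal.ofReal (w₂ z.2)) volume :=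
    ((hw₁m.comp measurable_fst).ennreal_ofReal.mul (hw₂m.comp measurable_snd).ennreal_ofReal).aemeasurable
  have hlt : ∀ᵐ z : HiggsLattice.VecField P k × Crd P N k ∂volume, ENNReal.ofReal (w₁ z.1) * ENNReal.ofReal (w₂ z.2) < ∞ :=
    Filter.Eventually.of_forall fun z => ENNReal.mul_lt_top ENNReal.ofReal_lt_top ENNReal.ofReal_lt_top
  have hL1 : ∫ ω, G ω ∂(law356 C Ω B μ0sq msq a k)
      = (Z₁⁻¹ * Z₂⁻¹) * ∫ z : HiggsLattice.VecField P k × Crd P N k, (w₁ z.1 * w₂ z.2) * G z := by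
    rw [hlaw, integral_smul_measure, integral_withDensity_eq_integral_toReal_smul₀ hF hlt]
    have hc : ((ENNReal.ofReal Z₁)⁻¹ * ENNReal.ofReal Z₂⁻¹).toReal = Z₁⁻¹ * Z₂⁻¹ := by
      rw [ENNReal.toReal_mul, ENNReal.toReal_inv, ENNReal.toReal_ofReal hZ₁pos.le, ENNReal.toReal_ofReal (inv_nonneg.2 hZ₂pos.le)]
    rw [hc, smul_eq_mul]
    congr 1
    refine integral_congr_ae (Filter.Eventually.of_forall fun z => ?_)
    simp only [smul_eq_mul, ENNReal.toReal_mul, ENNReal.toReal_ofReal (hw₁0 _), ENNReal.toReal_ofReal (hw₂0 _)]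
  -- (3) transport to the coordinates `S356 → ℝ`
  have hΨ : MeasurePreserving (MeasurableEquiv.sumPiEquivProdPi fun _ : S356 P N k => ℝ) volume volume :=
    volume_measurePreserving_sumPiEquivProdPi _
  have hnum : ∫ φ : S356 P N k → ℝ, G (Ψ k φ) * (weight (blockPrec C Ω B μ0sq msq a k) φ * source 0 φ)
      = ∫ z : HiggsLattice.VecField P k × Crd P N k, (w₁ z.1 * w₂ z.2) * G z := by
    have h : ∫ φ : S356 P N k → ℝ, (w₁ (Ψ k φ).1 * w₂ (Ψ k φ).2) * G (Ψ k φ)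
        = ∫ z : HiggsLattice.VecField P k × Crd P N k, (w₁ z.1 * w₂ z.2) * G z :=
      hΨ.integral_comp (MeasurableEquiv.measurableEmbedding _)
        (fun z : HiggsLattice.VecField P k × Crd P N k => (w₁ z.1 * w₂ z.2) * G z)
    rw [← h]
    refine integral_congr_ae (Filter.Eventually.of_forall fun φ => ?_)
    simp only [weight_blockPrec, B3GaussianPerturbationGraphs.source_zero, mul_one]
    show G (Ψ k φ) * (w₁ (Ψ k φ).1 * w₂ (Ψ k φ).2) = w₁ (Ψ k φ).1 * w₂ (Ψ k φ).2 * G (Ψ k φ)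
    ring
  have hden : ∫ φ : S356 P N k → ℝ, weight (blockPrec C Ω B μ0sq msq a k) φ * source 0 φ = Z₁ * Z₂ := by
    simp only [B3GaussianPerturbationGraphs.source_zero, mul_one]
    exact integral_weight_blockPrec C Ω B μ0sq msq a k
  rw [hL1, gexp, hnum, hden]
  field_simp

end Transport

/-! ## §4 The legs of (3.57) are linear functionals of the coordinates; `V^{(k)} ∘ Ψ` is the engine's cluster variable -/

section Legs

open B2Eq228Conditioning (resIn)
open B1Eq221Coordinates (fieldCoord)
open HiggsCovariance (E)
open B1Eq324SmallFieldLeaf (siteDelta siteInner_siteDelta)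
open B1Prop32InteractionBound (Leg legVal)
open B3GaussianPerturbationGraphs (clusterVar legProd)
open B1Eq323ConnectedGraphBound (cdeg)

variable {P : HiggsLattice.Params} {N : ℕ} (k : ℕ)

open Classical in
/-- THE LEG VECTORS: the unit-lattice components `(L^kε)^{(d−2)/2}φ′_j(y)`, `(L^kε)^{(d−2)/2}A′_μ(y)` of (1.22)/(3.57) are the linear functionals
`φ ↦ φ·v` of the coordinates `φ : S356 → ℝ`, `v = legVecS k l y` (the scalar leg through the typer's `fieldOfCrd`, r14's `siteDelta`).
[cite: Balaban1982Higgs1, Prop. 3.2 (3.57) p.622; (1.22) p.607] -/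
def legVecS : Leg N P.d → HiggsLattice.Site P k → (S356 P N k → ℝ)
  | Sum.inl j, y => Sum.elim 0
      (fun t => P.mesh k ^ (((P.d : ℝ) - 2) / 2) * (P.mesh k ^ P.d
        * resIn (inSet N (Finset.univ : Finset (HiggsLattice.Site P k))) (fieldCoord (E N) (HiggsLattice.Site P k) (siteDelta y j)) t))
  | Sum.inr μ, y => Sum.elim (fun b => if b = ⟨y, μ⟩ then P.mesh k ^ (((P.d : ℝ) - 2) / 2) else 0) 0

/-- `φ·(legVecS k l y) = legVal k A′ φ′ l y` at `(A′, x) = Ψ φ`, `φ′ = fieldOfCrd x`. [cite: Balaban1982Higgs1, Prop. 3.2 (3.57) p.622; (1.22) p.607] -/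
theorem dotProduct_legVecS (l : Leg N P.d) (y : HiggsLattice.Site P k) (φ : S356 P N k → ℝ) :
    φ ⬝ᵥ legVecS k l y = legVal k (Ψ k φ).1 (fieldOfCrd Finset.univ (Ψ k φ).2) l y := by
  classical
  have hφ : φ = Sum.elim (fun b => φ (Sum.inl b)) (fun s => φ (Sum.inr s)) := by
    ext (b | s) <;> rfl
  cases l with
  | inl j =>
    rw [B1Eq357FluctuationPolynomial.legVal_inl, ← siteInner_siteDelta y j (fieldOfCrd _ _), HiggsCondGauss228.siteInner_fieldOfCrd]
    conv_lhs => rw [hφ]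
    rw [legVecS, sumElim_dotProduct_sumElim, dotProduct_zero, zero_add]
    simp only [dotProduct, Finset.mul_sum]
    refine Finset.sum_congr rfl fun t _ => ?_
    show φ (Sum.inr t) * _ = _ * (_ * (_ * φ (Sum.inr t)))
    ring
  | inr μ =>
    rw [B1Eq357FluctuationPolynomial.legVal_inr]
    conv_lhs => rw [hφ]
    rw [legVecS, sumElim_dotProduct_sumElim, dotProduct_zero, add_zero]
    simp only [dotProduct, mul_ite, mul_zero, Finset.sum_ite_eq', Finset.mem_univ, if_true]
    rw [mul_comm]
    rfl

variable (qmax : ℕ)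

/-- THE ENGINE'S LEG VECTORS of a monomial index `c = (q, z, κ)` of (3.57): `v_{c,i} = legVecS (κ_i) (z_i)` for `i < q` (junk `0` otherwise).
[cite: Balaban1982Higgs1, Prop. 3.2 (3.57) p.622] -/
def lvOf (c : Idx P N k qmax) (i : ℕ) : S356 P N k → ℝ :=
  if h : i < (c.1 : ℕ) then legVecS k (c.2.2 ⟨i, h⟩) (c.2.1 ⟨i, h⟩) else 0

/-- `φ·v_{c,i}` is the typer's leg variable `legRV c i` read in the coordinates `Ψ`. [cite: Balaban1982Higgs1, Prop. 3.2 (3.57) p.622] -/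
theorem dotProduct_lvOf (c : Idx P N k qmax) (i : ℕ) (φ : S356 P N k → ℝ) :
    φ ⬝ᵥ lvOf k qmax c i = legRV k qmax c i (Ψ k φ) := by
  unfold lvOf legRV
  split_ifs with h
  · exact dotProduct_legVecS k _ _ φ
  · exact dotProduct_zero _

variable (coef : (q : ℕ) → (Fin q → HiggsLattice.Site P k) → (Fin q → Leg N P.d) → ℝ)

/-- **`V^{(k)} ∘ Ψ` IS THE ENGINE'S CLUSTER VARIABLE**: with every monomial index allowed, coefficients `coefOf`, degrees `cdeg c = q` and legs
`lvOf`, p33's `clusterVar` at any cluster label is `V^{(k)}` of (3.57) read in the coordinates (the typer's slot normal form `rv357_eq_sum_prod`).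
[cite: Balaban1982Higgs1, Prop. 3.2 (3.57) p.622] -/
theorem clusterVar_eq_rv357 {n : ℕ} (j : Fin n) (φ : S356 P N k → ℝ) :
    clusterVar (fun _ : Fin n => (Finset.univ : Finset (Idx P N k qmax))) (fun _ => coefOf k qmax coef) cdeg (lvOf k qmax) j φ
      = rv357 k qmax coef (Ψ k φ) := by
  rw [clusterVar, B1Eq357FluctuationPolynomial.rv357_eq_sum_prod]
  refine Finset.sum_congr rfl fun c _ => ?_
  congr 1
  unfold legProd slots
  rw [Finset.prod_range]
  exact Finset.prod_congr rfl fun i _ => dotProduct_lvOf k qmax c i φ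

end Legs

/-! ## §5 `⟨(V^{(k)})ⁿ⟩^T` on the law of (3.56) is the engine's Ursell function; the bound `|⟨(V^{(k)})ⁿ⟩^T| ≦ connConst·A₀ⁿ·|T^{(k)}|` -/

section Cumulant

open Literature.Probability.LatticeModels (ursellOf cumulantOf)
open B10Eq24Cumulant (nmoment)
open B3GaussianPerturbationGraphs (jmoment clusterVar)
open B1Prop32InteractionBound (Leg legVal card_leg)
open B1Ineq358TreeDecaySum (diam)
open B1Eq323ConnectedGraphBound (cdeg connConst abs_ursellOf_jmoment_le)

variable {P : HiggsLattice.Params} {N : ℕ}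
  (C : ChargeData N) (Ω : Finset (HiggsLattice.Site P 0)) (B : HiggsLattice.VecField P 0)

open Classical in
/-- **THE MOMENTS `⟨Π_{j∈Q}X_j⟩` OF THE ENGINE ARE THE MOMENTS `⟨(V^{(k)})^{|Q|}⟩` OF (3.23) ON THE LAW OF (3.56)** (`n` copies of the one
polynomial `V^{(k)}`; `μ₀², m² > 0`, `a > 0`, `L > 1`, `k ≤ K`). [cite: Balaban1982Higgs1, (3.23) p.616; (3.56)–(3.57) p.622] -/
theorem jmoment_blockPrec_eq_nmoment {μ0sq msq a : ℝ} (hμ : 0 < μ0sq) (hmsq : 0 < msq) (ha : 0 < a) (hL : 1 < (P.L : ℝ))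
    {k : ℕ} (hk : k ≤ P.K) (qmax : ℕ) (coef : (q : ℕ) → (Fin q → HiggsLattice.Site P k) → (Fin q → Leg N P.d) → ℝ) {n : ℕ}
    (Q : Finset (Fin n)) :
    jmoment (blockPrec C Ω B μ0sq msq a k) (fun _ : Fin n => (Finset.univ : Finset (Idx P N k qmax))) (fun _ => coefOf k qmax coef) cdeg
        (lvOf k qmax) Q
      = nmoment (rv357 k qmax coef) (law356 C Ω B μ0sq msq a k) Q.card := by
  haveI := B1Eq357FluctuationPolynomial.isProbabilityMeasure_law356 C Ω B hμ hmsq ha hL hk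
  rw [nmoment, probReal_univ, div_one, integral_law356_eq_gexp C Ω B hμ hmsq ha hL hk, jmoment]
  congr 1
  funext φ
  rw [Finset.prod_congr rfl fun j _ => clusterVar_eq_rv357 k qmax coef j φ, Finset.prod_const]

open Classical in
/-- **`⟨(V^{(k)})ⁿ⟩^T` (the `n`-th cumulant of `V^{(k)}` on the law of (3.56), `cumulantOf (nmoment …) n` of the B1.Eq3.59 chain) IS THE ENGINE'S
URSELL FUNCTION `⟨X_1;…;X_n⟩^T`** of `n` copies of `V^{(k)}` in p13's Gaussian `gexp (blockPrec) 0`. [cite: Balaban1982Higgs1, (3.23) p.616; (3.56) p.622] -/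
theorem cumulantOf_rv357_eq_ursellOf {μ0sq msq a : ℝ} (hμ : 0 < μ0sq) (hmsq : 0 < msq) (ha : 0 < a) (hL : 1 < (P.L : ℝ))
    {k : ℕ} (hk : k ≤ P.K) (qmax : ℕ) (coef : (q : ℕ) → (Fin q → HiggsLattice.Site P k) → (Fin q → Leg N P.d) → ℝ) (n : ℕ) :
    cumulantOf (nmoment (rv357 k qmax coef) (law356 C Ω B μ0sq msq a k)) n
      = ursellOf (jmoment (blockPrec C Ω B μ0sq msq a k) (fun _ : Fin n => (Finset.univ : Finset (Idx P N k qmax)))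
          (fun _ => coefOf k qmax coef) cdeg (lvOf k qmax)) Finset.univ := by
  unfold cumulantOf
  congr 1
  funext Q
  exact (jmoment_blockPrec_eq_nmoment C Ω B hμ hmsq ha hL hk qmax coef Q).symm

/-- **`|⟨(V^{(k)})ⁿ⟩^T| ≦ connConst·A₀ⁿ·|T^{(k)}|` FOR THE DISPLAYED `V^{(k)}` OF (3.57) ON THE LAW OF (3.56)** — p. 616: *"⟨Vⁿ⟩^T is the expression
corresponding to the sum of connected graphs with exponentially decaying propagators. Hence ⟨Vⁿ⟩^T = O(ε^κ)|T₁|"*: under (3.58) in the diameter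
currency (`|v^{(k)}(q;z;κ)| ≦ A₀e^{−δ₀·diam z}`, the typer's `h358` shape) and exponentially decaying propagators of the unit-lattice legs under
`dμ_{C^{(k)}}(A′)dμ_{C^{(k)}(B^{(k+1)})}(φ′)` (Prop. 2.3 (2.34)–(2.35), AN INPUT here), for `n ≧ 1`, `μ₀², m² > 0`, `a > 0`, `L > 1`, `k ≤ K`; the
constant `connConst` (r14's `B1Eq323ConnectedGraphBound`) does not depend on `T^{(k)}`. [cite: Balaban1982Higgs1, (3.23) p.616; Prop. 3.2 (3.56)–(3.58) p.622] -/
theorem abs_cumulantOf_rv357_le {μ0sq msq a : ℝ} (hμ : 0 < μ0sq) (hmsq : 0 < msq) (ha : 0 < a) (hL : 1 < (P.L : ℝ))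
    {k : ℕ} (hk : k ≤ P.K) (qmax : ℕ) (coef : (q : ℕ) → (Fin q → HiggsLattice.Site P k) → (Fin q → Leg N P.d) → ℝ) {n : ℕ} [NeZero n]
    {A₀ δ₀ c₀ δ₁ : ℝ} (hA₀ : 0 ≤ A₀) (hδ₀ : 0 < δ₀) (hc₀ : 0 ≤ c₀) (hδ₁ : 0 < δ₁)
    (h358 : ∀ q, q ≤ qmax → ∀ (z : Fin q → HiggsLattice.Site P k) (κ : Fin q → Leg N P.d),
      |coef q z κ| ≤ A₀ * Real.exp (-(δ₀ * (diam z : ℝ))))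
    (hprop : ∀ (l l' : Leg N P.d) (y y' : HiggsLattice.Site P k),
      |∫ ω, legVal k ω.1 (fieldOfCrd Finset.univ ω.2) l y * legVal k ω.1 (fieldOfCrd Finset.univ ω.2) l' y' ∂(law356 C Ω B μ0sq msq a k)|
        ≤ c₀ * Real.exp (-(δ₁ * (HiggsLattice.Site.tdist y y' : ℝ)))) :
    |cumulantOf (nmoment (rv357 k qmax coef) (law356 C Ω B μ0sq msq a k)) n|
      ≤ connConst P.d (N + P.d) n qmax c₀ δ₀ δ₁ * A₀ ^ n * Fintype.card (HiggsLattice.Site P k) := by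
  classical
  rw [cumulantOf_rv357_eq_ursellOf C Ω B hμ hmsq ha hL hk qmax coef n, ← card_leg N P.d]
  refine abs_ursellOf_jmoment_le (blockPrec C Ω B μ0sq msq a k) (fun _ => coefOf k qmax coef) (lvOf k qmax)
    (blockPrec_posDef C Ω B hμ hmsq ha hL hk) hA₀ hδ₀ hc₀ hδ₁ (fun _ c => ?_) (fun c c' i i' => ?_)
  · exact h358 c.1 (Nat.lt_succ_iff.1 c.1.isLt) c.2.1 c.2.2
  · have h := hprop (c.2.2 i) (c'.2.2 i') (c.2.1 i) (c'.2.1 i')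
    rw [integral_law356_eq_gexp C Ω B hμ hmsq ha hL hk] at h
    have e : (fun φ : S356 P N k → ℝ => (φ ⬝ᵥ lvOf k qmax c i) * (φ ⬝ᵥ lvOf k qmax c' i'))
        = fun φ => legVal k (Ψ k φ).1 (fieldOfCrd Finset.univ (Ψ k φ).2) (c.2.2 i) (c.2.1 i)
            * legVal k (Ψ k φ).1 (fieldOfCrd Finset.univ (Ψ k φ).2) (c'.2.2 i') (c'.2.1 i') := by
      funext φ
      rw [dotProduct_lvOf, dotProduct_lvOf, B1Eq357FluctuationPolynomial.legRV_of_lt k qmax c i.isLt,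
        B1Eq357FluctuationPolynomial.legRV_of_lt k qmax c' i'.isLt]
    rw [e]
    exact h

/-- **THE SAME WITH THE SCALE POWER DISPLAYED** — (3.58) as printed, `|v^{(k)}| ≦ O(1)(L^kε)^{κ₀}e^{−δ₀d(…)}` (`A₀ = C_v·(L^kε)^{κ₀}`): 
`|⟨(V^{(k)})ⁿ⟩^T| ≦ connConst·C_vⁿ·(L^kε)^{κ₀n}·|T^{(k)}|` — *"Hence ⟨Vⁿ⟩^T = O(ε^κ)|T₁| with κ > d for n sufficiently large"* (`κ = nκ₀`).
[cite: Balaban1982Higgs1, (3.23) p.616; Prop. 3.2 (3.58) p.622] -/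
theorem abs_cumulantOf_rv357_le_scale {μ0sq msq a : ℝ} (hμ : 0 < μ0sq) (hmsq : 0 < msq) (ha : 0 < a) (hL : 1 < (P.L : ℝ))
    {k : ℕ} (hk : k ≤ P.K) (qmax : ℕ) (coef : (q : ℕ) → (Fin q → HiggsLattice.Site P k) → (Fin q → Leg N P.d) → ℝ) {n : ℕ} [NeZero n]
    {Cv κ₀ δ₀ c₀ δ₁ : ℝ} (hCv : 0 ≤ Cv) (hδ₀ : 0 < δ₀) (hc₀ : 0 ≤ c₀) (hδ₁ : 0 < δ₁)
    (h358 : ∀ q, q ≤ qmax → ∀ (z : Fin q → HiggsLattice.Site P k) (κ : Fin q → Leg N P.d),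
      |coef q z κ| ≤ Cv * P.mesh k ^ κ₀ * Real.exp (-(δ₀ * (diam z : ℝ))))
    (hprop : ∀ (l l' : Leg N P.d) (y y' : HiggsLattice.Site P k),
      |∫ ω, legVal k ω.1 (fieldOfCrd Finset.univ ω.2) l y * legVal k ω.1 (fieldOfCrd Finset.univ ω.2) l' y' ∂(law356 C Ω B μ0sq msq a k)|
        ≤ c₀ * Real.exp (-(δ₁ * (HiggsLattice.Site.tdist y y' : ℝ)))) :
    |cumulantOf (nmoment (rv357 k qmax coef) (law356 C Ω B μ0sq msq a k)) n|
      ≤ connConst P.d (N + P.d) n qmax c₀ δ₀ δ₁ * Cv ^ n * P.mesh k ^ (κ₀ * n) * Fintype.card (HiggsLattice.Site P k) := by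
  have hs : 0 ≤ P.mesh k := (P.mesh_pos k).le
  have h := abs_cumulantOf_rv357_le (n := n) C Ω B hμ hmsq ha hL hk qmax coef (mul_nonneg hCv (Real.rpow_nonneg hs κ₀)) hδ₀ hc₀ hδ₁ h358 hprop
  rw [mul_pow, ← Real.rpow_mul_natCast hs] at h
  calc _ ≤ _ := h
    _ = _ := by ring

end Cumulant

/-! ## §6 *"exponentially decaying propagators"*: the second moments of the legs are the covariance kernels (2.30)/(2.32) of the two factors -/

section Propagators

open B1Prop32InteractionBound (Leg legVal)
open B1Eq324SmallFieldLeaf (bondDelta siteDelta siteInner_bondDelta siteInner_siteDelta)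
open HiggsFluctMeasure (fluctCov)
open HiggsCondCov232 (condCov232)
open B1Ineq358TreeDecaySum (diam)
open Literature.Probability.LatticeModels (cumulantOf)
open B10Eq24Cumulant (nmoment)
open B1Eq323ConnectedGraphBound (connConst)

variable {P : HiggsLattice.Params} {N : ℕ}
  (C : ChargeData N) (Ω : Finset (HiggsLattice.Site P 0)) (B : HiggsLattice.VecField P 0)

/-- THE PROPAGATOR KERNEL of a pair of unit-lattice legs under the law of (3.56): vector–vector = the covariance `C^{(k)}` of (2.30) between the two
bonds, scalar–scalar = the covariance `C^{(k)}(B^{(k+1)}) = C^{(k)}_{T^{(k)}}(Ω, B)` of (2.32) between the two components (both in the pairing (1.5)),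
mixed = `0` (independence, p. 617). [cite: Balaban1982Higgs1, (2.30) p.611; (2.32) p.611; p.617] -/
def propKer (μ0sq msq a : ℝ) (k : ℕ) : Leg N P.d → HiggsLattice.Site P k → Leg N P.d → HiggsLattice.Site P k → ℝ
  | Sum.inr μ, y, Sum.inr μ', y' =>
      siteInner (toSite (bondDelta (⟨y, μ⟩ : HiggsLattice.PBond P k))) (fluctCov P μ0sq a k (toSite (bondDelta ⟨y', μ'⟩)))
  | Sum.inl j, y, Sum.inl j', y' =>
      siteInner (siteDelta y j) (condCov232 C Ω B msq a k (Finset.univ : Finset (HiggsLattice.Site P k)) (siteDelta y' j'))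
  | Sum.inr _, _, Sum.inl _, _ => 0
  | Sum.inl _, _, Sum.inr _, _ => 0

/-- **THE SECOND MOMENTS OF THE LEGS UNDER `dμ_{C^{(k)}}(A′)dμ_{C^{(k)}(B^{(k+1)})}(φ′)` ARE `(L^kε)^{d−2}×` THE COVARIANCE KERNELS** (the two
factors are centred Gaussians with the covariances `C^{(k)}` (2.30) and `C^{(k)}(B^{(k+1)})` (2.32) — the typer's
`integral_siteInner_mul_siteInner_fluctMeasure` / `integral_siteInner_mul_siteInner_condGauss` — and independent, p. 617; `μ₀², m² > 0`, `a > 0`,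
`L > 1`, `k ≤ K`). [cite: Balaban1982Higgs1, (2.30) p.611; (2.32) p.611; p.617; (3.56) p.622] -/
theorem integral_legVal_mul_legVal {μ0sq msq a : ℝ} (hμ : 0 < μ0sq) (hmsq : 0 < msq) (ha : 0 < a) (hL : 1 < (P.L : ℝ))
    {k : ℕ} (hk : k ≤ P.K) (l l' : Leg N P.d) (y y' : HiggsLattice.Site P k) :
    ∫ ω, legVal k ω.1 (fieldOfCrd Finset.univ ω.2) l y * legVal k ω.1 (fieldOfCrd Finset.univ ω.2) l' y' ∂(law356 C Ω B μ0sq msq a k)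
      = P.mesh k ^ ((P.d : ℝ) - 2) * propKer C Ω B μ0sq msq a k l y l' y' := by
  haveI := HiggsFluctMeasurePos.fluctMeasure_isProbability (P := P) hμ ha hL hk
  haveI := HiggsCondGauss228.isProbabilityMeasure_condGauss C Ω B hmsq ha hL hk (Finset.univ : Finset (HiggsLattice.Site P k))
  set c : ℝ := P.mesh k ^ (((P.d : ℝ) - 2) / 2) with hc
  have hcc : c * c = P.mesh k ^ ((P.d : ℝ) - 2) := by
    rw [hc, ← Real.rpow_add (P.mesh_pos k)]
    congr 1
    ring
  have hA0 : ∀ b : HiggsLattice.PBond P k, ∫ A, A b ∂(fluctMeasure P μ0sq a k) = 0 := by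
    intro b
    have h := HiggsFluctMeasureCov.integral_siteInner_fluctMeasure (P := P) μ0sq a k (bondDelta b)
    simp_rw [siteInner_bondDelta] at h
    exact h
  have hAA : ∀ b b' : HiggsLattice.PBond P k, ∫ A, A b * A b' ∂(fluctMeasure P μ0sq a k)
      = siteInner (toSite (bondDelta b)) (fluctCov P μ0sq a k (toSite (bondDelta b'))) := by
    intro b b'
    have h := HiggsFluctMeasureCov.integral_siteInner_mul_siteInner_fluctMeasure (P := P) hμ ha hL hk (bondDelta b) (bondDelta b')
    simp_rw [siteInner_bondDelta] at h
    exact h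
  have hφ0 : ∀ (z : HiggsLattice.Site P k) (i : Fin N),
      ∫ x, fieldOfCrd Finset.univ x z i ∂(condGauss C Ω B msq a k (Finset.univ : Finset (HiggsLattice.Site P k))) = 0 := by
    intro z i
    have h := HiggsCondGaussMoments.integral_siteInner_condGauss C Ω B hmsq ha hL hk (Finset.univ : Finset (HiggsLattice.Site P k))
      (siteDelta z i)
    simp_rw [siteInner_siteDelta] at h
    exact h
  have hφφ : ∀ (z z' : HiggsLattice.Site P k) (i i' : Fin N),
      ∫ x, fieldOfCrd Finset.univ x z i * fieldOfCrd Finset.univ x z' i' ∂(condGauss C Ω B msq a k (Finset.univ : Finset (HiggsLattice.Site P k)))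
        = siteInner (siteDelta z i) (condCov232 C Ω B msq a k Finset.univ (siteDelta z' i')) := by
    intro z z' i i'
    have h := HiggsCondGaussMoments.integral_siteInner_mul_siteInner_condGauss C Ω B hmsq ha hL hk
      (Finset.univ : Finset (HiggsLattice.Site P k)) (siteDelta z i) (siteDelta z' i')
    simp_rw [siteInner_siteDelta] at h
    rw [h, siteInner_siteDelta]
  rw [B1Eq357FluctuationPolynomial.law356_eq]
  rcases l with j | μ <;> rcases l' with j' | μ'
  · -- scalar–scalar
    simp only [B1Eq357FluctuationPolynomial.legVal_inl, propKer]
    have h := integral_prod_mul (μ := fluctMeasure P μ0sq a k)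
      (ν := condGauss C Ω B msq a k (Finset.univ : Finset (HiggsLattice.Site P k)))
      (fun _ : HiggsLattice.VecField P k => (1 : ℝ)) (fun x => (c * fieldOfCrd Finset.univ x y j) * (c * fieldOfCrd Finset.univ x y' j'))
    simp only [one_mul, integral_const, probReal_univ, one_smul] at h
    rw [h]
    have e : (fun x : Crd P N k => c * fieldOfCrd Finset.univ x y j * (c * fieldOfCrd Finset.univ x y' j'))
        = fun x => (c * c) * (fieldOfCrd Finset.univ x y j * fieldOfCrd Finset.univ x y' j') := by
      funext x; ring
    rw [e, integral_const_mul, hφφ, hcc]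
  · -- scalar–vector
    simp only [B1Eq357FluctuationPolynomial.legVal_inl, B1Eq357FluctuationPolynomial.legVal_inr, propKer, mul_zero]
    have h := integral_prod_mul (μ := fluctMeasure P μ0sq a k)
      (ν := condGauss C Ω B msq a k (Finset.univ : Finset (HiggsLattice.Site P k)))
      (fun A : HiggsLattice.VecField P k => c * A ⟨y', μ'⟩) (fun x => c * fieldOfCrd Finset.univ x y j)
    have e : (fun ω : HiggsLattice.VecField P k × Crd P N k => c * fieldOfCrd Finset.univ ω.2 y j * (c * ω.1 ⟨y', μ'⟩))
        = fun ω => c * ω.1 ⟨y', μ'⟩ * (c * fieldOfCrd Finset.univ ω.2 y j) := by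
      funext ω; ring
    rw [e, h, integral_const_mul, integral_const_mul, hφ0, mul_zero, mul_zero]
  · -- vector–scalar
    simp only [B1Eq357FluctuationPolynomial.legVal_inl, B1Eq357FluctuationPolynomial.legVal_inr, propKer, mul_zero]
    have h := integral_prod_mul (μ := fluctMeasure P μ0sq a k)
      (ν := condGauss C Ω B msq a k (Finset.univ : Finset (HiggsLattice.Site P k)))
      (fun A : HiggsLattice.VecField P k => c * A ⟨y, μ⟩) (fun x => c * fieldOfCrd Finset.univ x y' j')
    rw [h, integral_const_mul, integral_const_mul, hA0, mul_zero, zero_mul]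
  · -- vector–vector
    simp only [B1Eq357FluctuationPolynomial.legVal_inr, propKer]
    have h := integral_prod_mul (μ := fluctMeasure P μ0sq a k)
      (ν := condGauss C Ω B msq a k (Finset.univ : Finset (HiggsLattice.Site P k)))
      (fun A : HiggsLattice.VecField P k => (c * A ⟨y, μ⟩) * (c * A ⟨y', μ'⟩)) (fun _ => (1 : ℝ))
    simp only [mul_one, integral_const, probReal_univ, one_smul] at h
    rw [h]
    have e : (fun A : HiggsLattice.VecField P k => c * A ⟨y, μ⟩ * (c * A ⟨y', μ'⟩)) = fun A => (c * c) * (A ⟨y, μ⟩ * A ⟨y', μ'⟩) := by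
      funext A; ring
    rw [e, integral_const_mul, hAA, hcc]

/-- **PROP. 2.3 (2.34) FOR THE TWO COVARIANCES ⇒ *"exponentially decaying propagators"* for the legs**: kernel bounds in the level currency
of the tree, `|⟨δ_b, C^{(k)}δ_{b′}⟩| ≦ c_A(L^kε)^{−(d−2)}e^{−δ₁|b−b′|}`, `|⟨δ_{y,j}, C^{(k)}(B^{(k+1)})δ_{y′,j′}⟩| ≦ c_φ(L^kε)^{−(d−2)}e^{−δ₁|y−y′|}` (INPUTS —
the printed (2.34) read in the pairing (1.5), the diagonal case being the currency of r14's `B1Eq324SmallFieldLeaf.bondVar_le_of_ineq233_lower'`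
`≦ γ₀⁻¹(L^kε)^{−(d−2)}`; row B1.Prop2.3 supplies instances; `c_A ≧ 0`) give the hypothesis `hprop` of `abs_cumulantOf_rv357_le` with the
SCALE-FREE constant `c₀ = max(c_A, c_φ)` (the leg normalisation `(L^kε)^{(d−2)/2}` of (1.22) cancels the level factor).
[cite: Balaban1982Higgs1, Prop. 2.3 (2.34) p.611; (1.22) p.607; (3.56) p.622] -/
theorem abs_integral_legVal_mul_legVal_le {μ0sq msq a : ℝ} (hμ : 0 < μ0sq) (hmsq : 0 < msq) (ha : 0 < a) (hL : 1 < (P.L : ℝ))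
    {k : ℕ} (hk : k ≤ P.K) {cA cφ δ₁ : ℝ} (hcA : 0 ≤ cA)
    (h234A : ∀ b b' : HiggsLattice.PBond P k,
      |siteInner (toSite (bondDelta b)) (fluctCov P μ0sq a k (toSite (bondDelta b')))|
        ≤ cA * P.mesh k ^ (-((P.d : ℝ) - 2)) * Real.exp (-(δ₁ * (HiggsLattice.Site.tdist b.src b'.src : ℝ))))
    (h234φ : ∀ (y y' : HiggsLattice.Site P k) (j j' : Fin N),
      |siteInner (siteDelta y j) (condCov232 C Ω B msq a k (Finset.univ : Finset (HiggsLattice.Site P k)) (siteDelta y' j'))|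
        ≤ cφ * P.mesh k ^ (-((P.d : ℝ) - 2)) * Real.exp (-(δ₁ * (HiggsLattice.Site.tdist y y' : ℝ))))
    (l l' : Leg N P.d) (y y' : HiggsLattice.Site P k) :
    |∫ ω, legVal k ω.1 (fieldOfCrd Finset.univ ω.2) l y * legVal k ω.1 (fieldOfCrd Finset.univ ω.2) l' y' ∂(law356 C Ω B μ0sq msq a k)|
      ≤ max cA cφ * Real.exp (-(δ₁ * (HiggsLattice.Site.tdist y y' : ℝ))) := by
  have hs : 0 < P.mesh k ^ ((P.d : ℝ) - 2) := Real.rpow_pos_of_pos (P.mesh_pos k) _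
  have hs' : 0 ≤ P.mesh k ^ (-((P.d : ℝ) - 2)) := Real.rpow_nonneg (P.mesh_pos k).le _
  have hss : P.mesh k ^ ((P.d : ℝ) - 2) * P.mesh k ^ (-((P.d : ℝ) - 2)) = 1 := by
    rw [← Real.rpow_add (P.mesh_pos k), add_neg_cancel, Real.rpow_zero]
  have hE : 0 ≤ Real.exp (-(δ₁ * (HiggsLattice.Site.tdist y y' : ℝ))) := (Real.exp_pos _).le
  have hm : 0 ≤ max cA cφ := hcA.trans (le_max_left _ _)
  have key : |propKer C Ω B μ0sq msq a k l y l' y'|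
      ≤ max cA cφ * P.mesh k ^ (-((P.d : ℝ) - 2)) * Real.exp (-(δ₁ * (HiggsLattice.Site.tdist y y' : ℝ))) := by
    rcases l with j | μ <;> rcases l' with j' | μ'
    · exact (h234φ y y' j j').trans
        (mul_le_mul_of_nonneg_right (mul_le_mul_of_nonneg_right (le_max_right _ _) hs') hE)
    · simp only [propKer, abs_zero]
      exact mul_nonneg (mul_nonneg hm hs') hE
    · simp only [propKer, abs_zero]
      exact mul_nonneg (mul_nonneg hm hs') hE
    · exact (h234A ⟨y, μ⟩ ⟨y', μ'⟩).trans
        (mul_le_mul_of_nonneg_right (mul_le_mul_of_nonneg_right (le_max_left _ _) hs') hE)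
  rw [integral_legVal_mul_legVal C Ω B hμ hmsq ha hL hk, abs_mul, abs_of_pos hs]
  calc P.mesh k ^ ((P.d : ℝ) - 2) * |propKer C Ω B μ0sq msq a k l y l' y'|
      ≤ P.mesh k ^ ((P.d : ℝ) - 2)
          * (max cA cφ * P.mesh k ^ (-((P.d : ℝ) - 2)) * Real.exp (-(δ₁ * (HiggsLattice.Site.tdist y y' : ℝ)))) :=
        mul_le_mul_of_nonneg_left key hs.le
    _ = (P.mesh k ^ ((P.d : ℝ) - 2) * P.mesh k ^ (-((P.d : ℝ) - 2)))
          * (max cA cφ * Real.exp (-(δ₁ * (HiggsLattice.Site.tdist y y' : ℝ)))) := by ring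
    _ = max cA cφ * Real.exp (-(δ₁ * (HiggsLattice.Site.tdist y y' : ℝ))) := by rw [hss, one_mul]

/-- **`|⟨(V^{(k)})ⁿ⟩^T| ≦ connConst·A₀ⁿ·|T^{(k)}|` FROM (3.58) AND PROP. 2.3 (2.34) FOR THE TWO COVARIANCES OF (3.56)** (`abs_cumulantOf_rv357_le` with
its propagator hypothesis discharged by `abs_integral_legVal_mul_legVal_le`; the constant `connConst d (N+d) n qmax (max c_A c_φ) δ₀ δ₁` does not
depend on `k`, `ε` or the volume). [cite: Balaban1982Higgs1, (3.23) p.616; Prop. 2.3 (2.34) p.611; Prop. 3.2 (3.56)–(3.58) p.622] -/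
theorem abs_cumulantOf_rv357_le_of_ineq234 {μ0sq msq a : ℝ} (hμ : 0 < μ0sq) (hmsq : 0 < msq) (ha : 0 < a) (hL : 1 < (P.L : ℝ))
    {k : ℕ} (hk : k ≤ P.K) (qmax : ℕ) (coef : (q : ℕ) → (Fin q → HiggsLattice.Site P k) → (Fin q → Leg N P.d) → ℝ) {n : ℕ} [NeZero n]
    {A₀ δ₀ cA cφ δ₁ : ℝ} (hA₀ : 0 ≤ A₀) (hδ₀ : 0 < δ₀) (hcA : 0 ≤ cA) (hδ₁ : 0 < δ₁)
    (h358 : ∀ q, q ≤ qmax → ∀ (z : Fin q → HiggsLattice.Site P k) (κ : Fin q → Leg N P.d),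
      |coef q z κ| ≤ A₀ * Real.exp (-(δ₀ * (diam z : ℝ))))
    (h234A : ∀ b b' : HiggsLattice.PBond P k,
      |siteInner (toSite (bondDelta b)) (fluctCov P μ0sq a k (toSite (bondDelta b')))|
        ≤ cA * P.mesh k ^ (-((P.d : ℝ) - 2)) * Real.exp (-(δ₁ * (HiggsLattice.Site.tdist b.src b'.src : ℝ))))
    (h234φ : ∀ (y y' : HiggsLattice.Site P k) (j j' : Fin N),
      |siteInner (siteDelta y j) (condCov232 C Ω B msq a k (Finset.univ : Finset (HiggsLattice.Site P k)) (siteDelta y' j'))|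
        ≤ cφ * P.mesh k ^ (-((P.d : ℝ) - 2)) * Real.exp (-(δ₁ * (HiggsLattice.Site.tdist y y' : ℝ)))) :
    |cumulantOf (nmoment (rv357 k qmax coef) (law356 C Ω B μ0sq msq a k)) n|
      ≤ connConst P.d (N + P.d) n qmax (max cA cφ) δ₀ δ₁ * A₀ ^ n * Fintype.card (HiggsLattice.Site P k) :=
  abs_cumulantOf_rv357_le C Ω B hμ hmsq ha hL hk qmax coef hA₀ hδ₀ (hcA.trans (le_max_left _ _)) hδ₁ h358
    (abs_integral_legVal_mul_legVal_le C Ω B hμ hmsq ha hL hk hcA h234A h234φ)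

/-- **THE SCALE FORM**: (3.58) as printed (`A₀ = C_v(L^kε)^{κ₀}`) and (2.34) for the two covariances give
`|⟨(V^{(k)})ⁿ⟩^T| ≦ connConst(d, N+d, n, qmax, max(c_A,c_φ), δ₀, δ₁)·C_vⁿ·(L^kε)^{κ₀n}·|T^{(k)}|` — every constant independent of `k`, `ε` and the
volume: the print's *"Hence ⟨Vⁿ⟩^T = O(ε^κ)|T₁| with κ > d for n sufficiently large"* (`κ = nκ₀`).
[cite: Balaban1982Higgs1, (3.23) p.616; Prop. 2.3 (2.34) p.611; Prop. 3.2 (3.58) p.622] -/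
theorem abs_cumulantOf_rv357_le_of_ineq234_scale {μ0sq msq a : ℝ} (hμ : 0 < μ0sq) (hmsq : 0 < msq) (ha : 0 < a) (hL : 1 < (P.L : ℝ))
    {k : ℕ} (hk : k ≤ P.K) (qmax : ℕ) (coef : (q : ℕ) → (Fin q → HiggsLattice.Site P k) → (Fin q → Leg N P.d) → ℝ) {n : ℕ} [NeZero n]
    {Cv κ₀ δ₀ cA cφ δ₁ : ℝ} (hCv : 0 ≤ Cv) (hδ₀ : 0 < δ₀) (hcA : 0 ≤ cA) (hδ₁ : 0 < δ₁)
    (h358 : ∀ q, q ≤ qmax → ∀ (z : Fin q → HiggsLattice.Site P k) (κ : Fin q → Leg N P.d),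
      |coef q z κ| ≤ Cv * P.mesh k ^ κ₀ * Real.exp (-(δ₀ * (diam z : ℝ))))
    (h234A : ∀ b b' : HiggsLattice.PBond P k,
      |siteInner (toSite (bondDelta b)) (fluctCov P μ0sq a k (toSite (bondDelta b')))|
        ≤ cA * P.mesh k ^ (-((P.d : ℝ) - 2)) * Real.exp (-(δ₁ * (HiggsLattice.Site.tdist b.src b'.src : ℝ))))
    (h234φ : ∀ (y y' : HiggsLattice.Site P k) (j j' : Fin N),
      |siteInner (siteDelta y j) (condCov232 C Ω B msq a k (Finset.univ : Finset (HiggsLattice.Site P k)) (siteDelta y' j'))|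
        ≤ cφ * P.mesh k ^ (-((P.d : ℝ) - 2)) * Real.exp (-(δ₁ * (HiggsLattice.Site.tdist y y' : ℝ)))) :
    |cumulantOf (nmoment (rv357 k qmax coef) (law356 C Ω B μ0sq msq a k)) n|
      ≤ connConst P.d (N + P.d) n qmax (max cA cφ) δ₀ δ₁ * Cv ^ n * P.mesh k ^ (κ₀ * n) * Fintype.card (HiggsLattice.Site P k) := by
  have hs : 0 ≤ P.mesh k := (P.mesh_pos k).le
  have h := abs_cumulantOf_rv357_le_of_ineq234 (n := n) C Ω B hμ hmsq ha hL hk qmax coef (mul_nonneg hCv (Real.rpow_nonneg hs κ₀)) hδ₀ hcA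
    hδ₁ h358 h234A h234φ
  rw [mul_pow, ← Real.rpow_mul_natCast hs] at h
  calc _ ≤ _ := h
    _ = _ := by ring

end Propagators

end Literature.MathematicalPhysics.QuantumFieldTheory.Balaban1983to89.B1Eq323DisplayedCumulantBound
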